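import Summits.QuantumAdvantage.QuantumAdvantage.Theses.CubicForrelation
import Summits.QuantumAdvantage.QuantumAdvantage.Theorems.CubicForrelationNearExactIsExactConcatAveraging
import Summits.QuantumAdvantage.QuantumAdvantage.Theorems.CubicForrelationNearExactIsExactBentDuality
import Summits.QuantumAdvantage.QuantumAdvantage.Theorems.CubicForrelationNearExactIsExactAmmCeilingX
import Summits.QuantumAdvantage.QuantumAdvantage.Theorems.CubicForrelationNearExactIsExactRmWeight
import Summits.QuantumAdvantage.QuantumAdvantage.Theorems.CubicForrelationNearExactIsExactDerivDegree

/-!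
# Crux `CubicForrelation.NearExactIsExact` (stmt-QuantumAdvantage-14043) — negative side (cdisprove, gen 8):
  the defect of a 4-concatenation is at least the quadratic distance of the dual difference

Disprover lemmas on the 4-concatenation `G = g₁ ‖ g₂ ‖ g₂ ‖ ¬g₁` of `…ConcatAveraging`
(`G(y,a,b) = g₁(y) ⊕ (a ⊕ b)(g₁ ⊕ g₂)(y) ⊕ ab`, `a = y(n)`, `b = y(n+1)`), whose Walsh dual for bent `g₁, g₂`
with duals `d₁, d₂` is the pattern `D = d₂ ‖ d₁ ‖ d₁ ‖ ¬d₂`, `D(u,a,b) = d₂(u) ⊕ (a ⊕ b) q(u) ⊕ ab`, `q = d₁ ⊕ d₂`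
the DUAL DIFFERENCE (`bb_W_concat_of_duals`); up to an affine change of `(a,b)` this is the "+2 indirect
extension" `x₁(x₂ ⊕ Q(y)) ⊕ g₁(y)`, `Q = g₁ ⊕ g₂`, the simplest Carlet indirect sum.
* `cd_core` / `cd_core_mul` — for cubic `f` on `n + 2` bits and ANY `D` with `D(u,0,b) ⊕ D(u,1,b) = q(u) ⊕ b`
  there are QUADRATIC `q₀, q₁` with `#{q ≠ q₀} + #{q ≠ q₁} ≤ #{f ≠ D}` (pair the slices `a = 0, 1`; the slice
  derivative of a cubic is quadratic — `stub_derivDegree` + `acx_deg_eval`); so `#{f ≠ D} ≥ 2·dist(q, RM(2,n))`.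
* `cd_forrelation_concat_le(_mul)` — bent branch, `m + m` bits: `Φ(f, G) ≤ 1 − dist(d₁ ⊕ d₂, RM(2))/2^{m+m}` for
  every cubic `f`; with `d₁` cubic the bound holds with the CUBIC distance of `d₂` (`…_of_cubic`: concatenating
  with an exact piece at best halves the defect), and `G` has no exact cubic partner if `d₂` is not cubic
  (`cd_no_exact_partner`).
* `cd_concat_exact_of_quadratic_diff` / `cd_concat_le_seven_eighths` — two EXACT pieces never land in
  `(7/8, 1)`: `d₁ ⊕ d₂` quadratic ⇒ `D` cubic and `Φ(D, G) = 1`; otherwise `Φ(f, G) ≤ 7/8` for all cubic `f`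
  (Reed–Muller minimum weight `stub_rmWeight`).
Role (DISPROOF.md §15.2′–15.4, HOME `run/shared/lean/b2b/cubic-forrelation/`): the kernel-checked "≤" half of
THEOREM IS(b) (`Φ_max = 1 − dist(q, RM(2,m))/2^m` for the +2 extension of an exact cubic bent `g₁` by a bent
quadratic modification `g₂ = g₁ ⊕ Q`) — the mechanism behind question Q15 (`dist(q, RM(2,12)) = 256` would give
`15/16` at `n = 14`; samplers found only `{0} ∪ [512, …)`) — and it closes the sub-habitat "4-concatenation of two
exact cubic bent functions" below `7/8` at every `n`. Sources: C. Carlet, *Boolean Functions for Cryptography and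
Coding Theory* (CUP 2021) §6.1.16 (4-decompositions of bent functions and their duals); S. Aaronson, A. Ambainis,
Forrelation, SIAM J. Comput. 47 (2018) §1.1.1; MacWilliams–Sloane (1977) Ch. 13. Proved from the tree
(`bb_W_concat_of_duals`, `stub_derivDegree`, `acx_deg_eval`, `stub_rmWeight`, `bb_isDegLeFun_bxor`, `bb_deg_*`);
standard axioms. [folklore]
-/

set_option linter.dupNamespace false -- D-0017: single-problem summit ⇒ `QuantumAdvantage.QuantumAdvantage` by design

noncomputable section

namespace Summit.QuantumAdvantage.QuantumAdvantage.Theorems.NearExactIsExact.Negative.ConcatDefect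

open Finset
open Literature.Computability.QuantumComplexity
open Literature.Computability.QuantumComplexity.BuzetChailloux (bxor zeroVec phi_signOf)
open Literature.Computability.QuantumComplexity.DerivativeWalsh (W fsum phi_eq_fsum fsum_eq_sum_mul_W
  sqrt_two_pow_three_mul)
open Summit.QuantumAdvantage.QuantumAdvantage.Theorems.CubicForrelation.NearExactIsExact
  (bb_W_concat_of_duals bb_signOf_mul_signOf bb_isDegLeFun_bxor bb_filter_bxor_eq bb_deg_xor bb_deg_and
   bb_deg_coord bb_deg_lift acx_deg_eval acx_deg_mono acx_bxor_append_zero stub_rmWeight stub_derivDegree)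

variable {n m : ℕ}

/-! ### Counting helpers -/

/-- A sum over `Fin 2 → Bool`, grouped by the second coordinate. -/
theorem cd_sum_fin_two (H : (Fin 2 → Bool) → ℕ) :
    ∑ v, H v = (H ![false, false] + H ![true, false]) + (H ![false, true] + H ![true, true]) := by
  rw [← (finTwoArrowEquiv Bool).symm.sum_comp, Fintype.sum_prod_type]
  simp only [Fintype.sum_bool, finTwoArrowEquiv_symm_apply]
  ring

/-- Fibre decomposition of a mismatch count on `n + 2` bits along the last two coordinates. -/
theorem cd_card_split (f D : (Fin (n + 2) → Bool) → Bool) :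
    (univ.filter fun z => f z ≠ D z).card =
      ((univ.filter fun u : Fin n → Bool => f (Fin.append u ![false, false]) ≠ D (Fin.append u ![false, false])).card +
        (univ.filter fun u : Fin n → Bool => f (Fin.append u ![true, false]) ≠ D (Fin.append u ![true, false])).card) +
      ((univ.filter fun u : Fin n → Bool => f (Fin.append u ![false, true]) ≠ D (Fin.append u ![false, true])).card +
        (univ.filter fun u : Fin n → Bool => f (Fin.append u ![true, true]) ≠ D (Fin.append u ![true, true])).card) := by
  have h : (univ.filter fun z => f z ≠ D z).card =
      ∑ ξ : Fin 2 → Bool, (univ.filter fun u : Fin n → Bool => f (Fin.append u ξ) ≠ D (Fin.append u ξ)).card := by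
    simp only [card_filter]
    rw [← (Fin.appendEquiv n 2).sum_comp, Fintype.sum_prod_type, sum_comm]
    rfl
  rw [h, cd_sum_fin_two]

/-- Translating `u ‖ (0,b)` by `0 ‖ (1,0)` gives `u ‖ (1,b)`. -/
theorem cd_bxor_append (u : Fin n → Bool) (b : Bool) :
    bxor (Fin.append u ![false, b]) (Fin.append zeroVec ![true, false]) = Fin.append u ![true, b] := by
  rw [acx_bxor_append_zero]
  congr 1
  funext i
  fin_cases i <;> cases b <;> rfl

/-- **The slice derivative of a cubic is quadratic** (shifted by the constant `b`):
`u ↦ f(u,0,b) ⊕ f(u,1,b) ⊕ b` has degree `≤ 2` for cubic `f` on `n + 2` bits. -/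
theorem cd_slice_deriv_quadratic (f : (Fin (n + 2) → Bool) → Bool) (hf : IsDegLeFun 3 f) (b : Bool) :
    IsDegLeFun 2 (fun u : Fin n → Bool =>
      (f (Fin.append u ![false, b]) ^^ f (Fin.append u ![true, b])) ^^ b) := by
  have hderiv : IsDegLeFun 2
      (fun z : Fin (n + 2) → Bool => f z ^^ f (bxor z (Fin.append zeroVec ![true, false]))) :=
    stub_derivDegree (n + 2) 2 f _ hf
  have h1 : IsDegLeFun 2 (fun u : Fin n → Bool => f (Fin.append u ![false, b]) ^^
      f (bxor (Fin.append u ![false, b]) (Fin.append zeroVec ![true, false]))) :=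
    acx_deg_eval (F := fun z : Fin (n + 2) → Bool => f z ^^ f (bxor z (Fin.append zeroVec ![true, false])))
      hderiv ![false, b]
  simp only [cd_bxor_append] at h1
  exact bb_isDegLeFun_bxor h1 (isDegLeFun_const 2 b)

/-! ### The core counting lemma -/

/-- **Core counting lemma.** Let `f` be cubic on `n + 2` bits and let `D` be ANY Boolean function whose two
`a`-slices at each `b` differ by `q ⊕ b`: `D(u,0,b) ⊕ D(u,1,b) = q(u) ⊕ b`. Then there are quadratic `q₀, q₁`
with `#{u : q u ≠ q₀ u} + #{u : q u ≠ q₁ u} ≤ #{z : f z ≠ D z}`; in words, `f` misses `D` in at least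
`2 · dist(q, RM(2,n))` points. -/
theorem cd_core (f D : (Fin (n + 2) → Bool) → Bool) (q : (Fin n → Bool) → Bool) (hf : IsDegLeFun 3 f)
    (hD : ∀ (u : Fin n → Bool) (b : Bool),
      (D (Fin.append u ![false, b]) ^^ D (Fin.append u ![true, b])) = (q u ^^ b)) :
    ∃ q₀ q₁ : (Fin n → Bool) → Bool, IsDegLeFun 2 q₀ ∧ IsDegLeFun 2 q₁ ∧
      (univ.filter fun u => q u ≠ q₀ u).card + (univ.filter fun u => q u ≠ q₁ u).card ≤
        (univ.filter fun z => f z ≠ D z).card := by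
  have key : ∀ b : Bool, ∃ qb : (Fin n → Bool) → Bool, IsDegLeFun 2 qb ∧
      (univ.filter fun u => q u ≠ qb u).card ≤
        (univ.filter fun u : Fin n → Bool => f (Fin.append u ![false, b]) ≠ D (Fin.append u ![false, b])).card +
          (univ.filter fun u : Fin n → Bool => f (Fin.append u ![true, b]) ≠ D (Fin.append u ![true, b])).card := by
    intro b
    refine ⟨fun u => (f (Fin.append u ![false, b]) ^^ f (Fin.append u ![true, b])) ^^ b,
      cd_slice_deriv_quadratic f hf b, ?_⟩
    refine (card_le_card ?_).trans (card_union_le _ _)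
    intro u hu
    simp only [mem_filter, mem_univ, true_and] at hu
    rw [mem_union, mem_filter, mem_filter]
    by_cases h0 : f (Fin.append u ![false, b]) = D (Fin.append u ![false, b])
    · refine Or.inr ⟨mem_univ _, fun h1 => hu ?_⟩
      rw [h0, h1, hD u b]
      cases q u <;> cases b <;> rfl
    · exact Or.inl ⟨mem_univ _, h0⟩
  obtain ⟨q₀, hq₀, k0⟩ := key false
  obtain ⟨q₁, hq₁, k1⟩ := key true
  refine ⟨q₀, q₁, hq₀, hq₁, ?_⟩
  rw [cd_card_split]
  omega

/-- **Weighted form.** If `T ≤ k · #{u : q u ≠ q₂ u}` for every quadratic `q₂` (e.g. `k = 1`,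
`T = dist(q, RM(2,n))`; or `k = 8`, `T = 2ⁿ` when `q` is a cubic outside `RM(2,n)`), then
`2T ≤ k · #{z : f z ≠ D z}` for every cubic `f`. -/
theorem cd_core_mul (f D : (Fin (n + 2) → Bool) → Bool) (q : (Fin n → Bool) → Bool) (k T : ℕ)
    (hf : IsDegLeFun 3 f)
    (hD : ∀ (u : Fin n → Bool) (b : Bool),
      (D (Fin.append u ![false, b]) ^^ D (Fin.append u ![true, b])) = (q u ^^ b))
    (hT : ∀ q₂ : (Fin n → Bool) → Bool, IsDegLeFun 2 q₂ → T ≤ k * (univ.filter fun u => q u ≠ q₂ u).card) :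
    2 * T ≤ k * (univ.filter fun z => f z ≠ D z).card := by
  obtain ⟨q₀, q₁, hq₀, hq₁, hle⟩ := cd_core f D q hf hD
  have h0 := hT q₀ hq₀
  have h1 := hT q₁ hq₁
  calc 2 * T = T + T := by ring
    _ ≤ k * (univ.filter fun u => q u ≠ q₀ u).card + k * (univ.filter fun u => q u ≠ q₁ u).card :=
        Nat.add_le_add h0 h1
    _ = k * ((univ.filter fun u => q u ≠ q₀ u).card + (univ.filter fun u => q u ≠ q₁ u).card) := by ring
    _ ≤ k * (univ.filter fun z => f z ≠ D z).card := Nat.mul_le_mul_left k hle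

/-! ### The 4-concatenation `g₁ ‖ g₂ ‖ g₂ ‖ ¬g₁` and its dual pattern `d₂ ‖ d₁ ‖ d₁ ‖ ¬d₂` -/

/-- The `a`-slices of the dual pattern `D = d₂ ‖ d₁ ‖ d₁ ‖ ¬d₂` differ by `(d₁ ⊕ d₂) ⊕ b`. -/
theorem cd_dual_slices (d₁ d₂ : (Fin n → Bool) → Bool) (u : Fin n → Bool) (b : Bool) :
    ((fun z : Fin (n + 2) → Bool => xor (xor (d₂ fun i => z (Fin.castAdd 2 i))
          ((xor (z (Fin.natAdd n 0)) (z (Fin.natAdd n 1))) &&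
            (xor (d₁ fun i => z (Fin.castAdd 2 i)) (d₂ fun i => z (Fin.castAdd 2 i)))))
          (z (Fin.natAdd n 0) && z (Fin.natAdd n 1))) (Fin.append u ![false, b]) ^^
      (fun z : Fin (n + 2) → Bool => xor (xor (d₂ fun i => z (Fin.castAdd 2 i))
          ((xor (z (Fin.natAdd n 0)) (z (Fin.natAdd n 1))) &&
            (xor (d₁ fun i => z (Fin.castAdd 2 i)) (d₂ fun i => z (Fin.castAdd 2 i)))))
          (z (Fin.natAdd n 0) && z (Fin.natAdd n 1))) (Fin.append u ![true, b])) =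
      ((d₁ u ^^ d₂ u) ^^ b) := by
  simp only [Fin.append_left, Fin.append_right, Matrix.cons_val_zero, Matrix.cons_val_one]
  cases b <;> cases d₁ u <;> cases d₂ u <;> rfl

/-- With `d₁` cubic, the quadratic distance of `d₁ ⊕ d₂` is at least the CUBIC distance of `d₂`. -/
theorem cd_quadratic_bound_of_cubic (d₁ d₂ : (Fin n → Bool) → Bool) (L : ℕ) (hd₁ : IsDegLeFun 3 d₁)
    (hL' : ∀ c : (Fin n → Bool) → Bool, IsDegLeFun 3 c → L ≤ (univ.filter fun u => c u ≠ d₂ u).card) :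
    ∀ q₂ : (Fin n → Bool) → Bool, IsDegLeFun 2 q₂ →
      L ≤ (univ.filter fun u => (d₁ u ^^ d₂ u) ≠ q₂ u).card := by
  intro q₂ hq₂
  have hc : IsDegLeFun 3 (fun u => d₁ u ^^ q₂ u) :=
    bb_isDegLeFun_bxor hd₁ (acx_deg_mono (by norm_num) hq₂)
  have h := hL' _ hc
  have e : (univ.filter fun u => (d₁ u ^^ q₂ u) ≠ d₂ u) =
      (univ.filter fun u => (d₁ u ^^ d₂ u) ≠ q₂ u) :=
    filter_congr fun u _ => by cases d₁ u <;> cases d₂ u <;> cases q₂ u <;> decide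
  rwa [e] at h

/-- If `d₁, d₂` are cubic and `d₁ ⊕ d₂` is NOT quadratic, then `2ⁿ ≤ 8 · #{u : (d₁ ⊕ d₂)(u) ≠ q₂(u)}` for every
quadratic `q₂` (the word `d₁ ⊕ d₂ ⊕ q₂` is a nonzero cubic; Reed–Muller minimum weight `stub_rmWeight`). -/
theorem cd_eight_mul_card_of_cubic_diff (d₁ d₂ : (Fin n → Bool) → Bool) (hd₁ : IsDegLeFun 3 d₁)
    (hd₂ : IsDegLeFun 3 d₂) (hq : ¬ IsDegLeFun 2 (fun u => d₁ u ^^ d₂ u)) :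
    ∀ q₂ : (Fin n → Bool) → Bool, IsDegLeFun 2 q₂ →
      2 ^ n ≤ 8 * (univ.filter fun u => (d₁ u ^^ d₂ u) ≠ q₂ u).card := by
  intro q₂ hq₂
  have he : IsDegLeFun 3 (fun u => (d₁ u ^^ d₂ u) ^^ q₂ u) :=
    bb_isDegLeFun_bxor (bb_isDegLeFun_bxor hd₁ hd₂) (acx_deg_mono (by norm_num) hq₂)
  have hne : ∃ u, ((d₁ u ^^ d₂ u) ^^ q₂ u) = true := by
    by_contra hall
    apply hq
    have e : (fun u => d₁ u ^^ d₂ u) = q₂ := funext fun u => by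
      have hu := not_exists.mp hall u
      revert hu
      cases d₁ u <;> cases d₂ u <;> cases q₂ u <;> decide
    rw [e]
    exact hq₂
  have h := stub_rmWeight stub_derivDegree n 3 _ he hne
  have e : (univ.filter fun u => ((d₁ u ^^ d₂ u) ^^ q₂ u) = true) =
      (univ.filter fun u => (d₁ u ^^ d₂ u) ≠ q₂ u) :=
    filter_congr fun u _ => by cases d₁ u <;> cases d₂ u <;> cases q₂ u <;> decide
  rw [e] at h
  calc 2 ^ n ≤ 2 ^ 3 * (univ.filter fun u => (d₁ u ^^ d₂ u) ≠ q₂ u).card := h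
    _ = 8 * (univ.filter fun u => (d₁ u ^^ d₂ u) ≠ q₂ u).card := by norm_num

/-! ### The forrelation form on the bent branch -/

/-- `Σ_x (-1)^{f(x)} (-1)^{d(x)} = 2^N − 2·#{x : f x ≠ d x}` (any `N`). -/
theorem cd_sum_signOf_mul_signOf {N : ℕ} (f d : (Fin N → Bool) → Bool) :
    ∑ x, signOf (f x) * signOf (d x) =
      (2 : ℝ) ^ N - 2 * ((univ.filter fun x => f x ≠ d x).card : ℝ) := by
  simp_rw [bb_signOf_mul_signOf]
  rw [sum_sub_distrib, sum_const, card_univ, Fintype.card_fun, Fintype.card_bool, Fintype.card_fin,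
    nsmul_eq_mul, mul_one, ← mul_sum, sum_boole]
  push_cast
  ring

/-- The duality formula with the constant `√(2^N)` (any `N`): if `W_g = √(2^N)·(-1)^{d}` pointwise then
`Φ(f,g) = 1 − 2·#{f ≠ d}/2^N` for every `f`. -/
theorem cd_forrelation_eq_of_dual {N : ℕ} (f g d : (Fin N → Bool) → Bool)
    (hd : ∀ x, W (fun y => signOf (g y)) x = Real.sqrt ((2 : ℝ) ^ N) * signOf (d x)) :
    forrelation f g = 1 - 2 * ((univ.filter fun x => f x ≠ d x).card : ℝ) / 2 ^ N := by
  rw [← phi_signOf, phi_eq_fsum, fsum_eq_sum_mul_W]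
  simp_rw [hd]
  have e : ∀ x : Fin N → Bool, signOf (f x) * (Real.sqrt ((2 : ℝ) ^ N) * signOf (d x)) =
      Real.sqrt ((2 : ℝ) ^ N) * (signOf (f x) * signOf (d x)) := fun x => by ring
  simp_rw [e]
  rw [← mul_sum, cd_sum_signOf_mul_signOf, sqrt_two_pow_three_mul]
  have h2 : (0 : ℝ) < (2 : ℝ) ^ N := by positivity
  have h1 : (0 : ℝ) < Real.sqrt ((2 : ℝ) ^ N) := Real.sqrt_pos.2 h2
  calc ((2 : ℝ) ^ N * Real.sqrt ((2 : ℝ) ^ N))⁻¹ *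
        (Real.sqrt ((2 : ℝ) ^ N) * ((2 : ℝ) ^ N - 2 * ((univ.filter fun x => f x ≠ d x).card : ℝ)))
      = (Real.sqrt ((2 : ℝ) ^ N) / Real.sqrt ((2 : ℝ) ^ N)) *
          (((2 : ℝ) ^ N - 2 * ((univ.filter fun x => f x ≠ d x).card : ℝ)) / (2 : ℝ) ^ N) := by ring
    _ = 1 - 2 * ((univ.filter fun x => f x ≠ d x).card : ℝ) / 2 ^ N := by
          rw [div_self h1.ne', one_mul, sub_div, div_self h2.ne']

/-- `√(2^{m+m+2}) = 2·2^m`. -/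
theorem cd_sqrt_two_pow (m : ℕ) : Real.sqrt ((2 : ℝ) ^ (m + m + 2)) = 2 * (2 : ℝ) ^ m := by
  rw [show (2 : ℝ) ^ (m + m + 2) = (2 * (2 : ℝ) ^ m) ^ 2 by ring, Real.sqrt_sq (by positivity)]

/-- Arithmetic step: `2T ≤ kC` turns `1 − 2C/(4P)` into `≤ 1 − T/(kP)`. -/
theorem cd_real_step {P : ℝ} (hP : 0 < P) {k T C : ℕ} (hk : 0 < k) (h : 2 * T ≤ k * C) :
    1 - 2 * (C : ℝ) / (4 * P) ≤ 1 - (T : ℝ) / ((k : ℝ) * P) := by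
  have hk' : (0 : ℝ) < (k : ℝ) := by exact_mod_cast hk
  have h' : (2 * T : ℝ) ≤ (k : ℝ) * C := by exact_mod_cast h
  have e1 : 2 * (C : ℝ) / (4 * P) = ((k : ℝ) * C / 2) / ((k : ℝ) * P) := by
    rw [div_eq_div_iff (by positivity) (by positivity)]
    ring
  rw [e1, sub_le_sub_iff_left]
  gcongr
  linarith

/-- **`Φ(f, G) ≤ 1 − T/(k·2^{m+m})` for every cubic `f`** whenever `T ≤ k·#{(d₁ ⊕ d₂) ≠ q₂}` for all
quadratic `q₂`, for the 4-concatenation `G = g₁ ‖ g₂ ‖ g₂ ‖ ¬g₁` of bent `g₁, g₂` (duals `d₁, d₂`) on `m + m`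
bits. (`k = 1`: `Φ ≤ 1 − dist(d₁ ⊕ d₂, RM(2))/2^{m+m}`.) -/
theorem cd_forrelation_concat_le_mul (g₁ g₂ d₁ d₂ : (Fin (m + m) → Bool) → Bool) (k T : ℕ) (hk : 0 < k)
    (h₁ : ∀ u, W (fun y => signOf (g₁ y)) u = (2 : ℝ) ^ m * signOf (d₁ u))
    (h₂ : ∀ u, W (fun y => signOf (g₂ y)) u = (2 : ℝ) ^ m * signOf (d₂ u))
    (hT : ∀ q₂ : (Fin (m + m) → Bool) → Bool, IsDegLeFun 2 q₂ →
      T ≤ k * (univ.filter fun u => (d₁ u ^^ d₂ u) ≠ q₂ u).card)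
    (f : (Fin (m + m + 2) → Bool) → Bool) (hf : IsDegLeFun 3 f) :
    forrelation f (fun y : Fin (m + m + 2) → Bool => xor (xor (g₁ fun i => y (Fin.castAdd 2 i))
          ((xor (y (Fin.natAdd (m + m) 0)) (y (Fin.natAdd (m + m) 1))) &&
            (xor (g₁ fun i => y (Fin.castAdd 2 i)) (g₂ fun i => y (Fin.castAdd 2 i)))))
          (y (Fin.natAdd (m + m) 0) && y (Fin.natAdd (m + m) 1))) ≤ 1 - (T : ℝ) / ((k : ℝ) * 2 ^ (m + m)) := by
  have hW := bb_W_concat_of_duals g₁ g₂ d₁ d₂ ((2 : ℝ) ^ m) h₁ h₂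
  rw [cd_forrelation_eq_of_dual f _ _ (fun z => by rw [hW z, cd_sqrt_two_pow]),
    show (2 : ℝ) ^ (m + m + 2) = 4 * 2 ^ (m + m) by ring]
  refine cd_real_step (by positivity) hk ?_
  exact cd_core_mul f _ (fun u => d₁ u ^^ d₂ u) k T hf (cd_dual_slices d₁ d₂) hT

/-- **`Φ(f, G) ≤ 1 − dist(d₁ ⊕ d₂, RM(2))/2^{m+m}`** for every cubic `f` (the case `k = 1`). -/
theorem cd_forrelation_concat_le (g₁ g₂ d₁ d₂ : (Fin (m + m) → Bool) → Bool) (L : ℕ)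
    (h₁ : ∀ u, W (fun y => signOf (g₁ y)) u = (2 : ℝ) ^ m * signOf (d₁ u))
    (h₂ : ∀ u, W (fun y => signOf (g₂ y)) u = (2 : ℝ) ^ m * signOf (d₂ u))
    (hL : ∀ q₂ : (Fin (m + m) → Bool) → Bool, IsDegLeFun 2 q₂ →
      L ≤ (univ.filter fun u => (d₁ u ^^ d₂ u) ≠ q₂ u).card)
    (f : (Fin (m + m + 2) → Bool) → Bool) (hf : IsDegLeFun 3 f) :
    forrelation f (fun y : Fin (m + m + 2) → Bool => xor (xor (g₁ fun i => y (Fin.castAdd 2 i))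
          ((xor (y (Fin.natAdd (m + m) 0)) (y (Fin.natAdd (m + m) 1))) &&
            (xor (g₁ fun i => y (Fin.castAdd 2 i)) (g₂ fun i => y (Fin.castAdd 2 i)))))
          (y (Fin.natAdd (m + m) 0) && y (Fin.natAdd (m + m) 1))) ≤ 1 - (L : ℝ) / 2 ^ (m + m) := by
  have h := cd_forrelation_concat_le_mul g₁ g₂ d₁ d₂ 1 L Nat.one_pos h₁ h₂
    (fun q₂ hq₂ => by simpa using hL q₂ hq₂) f hf
  simpa using h

/-- **Concatenating with an exact piece at best halves the defect.** If `d₁` is cubic (`g₁` exact) and `d₂` is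
at distance `≥ L` from every cubic, then every cubic `f` has `Φ(f, G) ≤ 1 − L/2^{m+m}`, i.e.
`1 − Φ_max(G) ≥ (1 − Φ_max(g₂))/2`. -/
theorem cd_forrelation_concat_le_of_cubic (g₁ g₂ d₁ d₂ : (Fin (m + m) → Bool) → Bool) (L : ℕ)
    (h₁ : ∀ u, W (fun y => signOf (g₁ y)) u = (2 : ℝ) ^ m * signOf (d₁ u))
    (h₂ : ∀ u, W (fun y => signOf (g₂ y)) u = (2 : ℝ) ^ m * signOf (d₂ u))
    (hd₁ : IsDegLeFun 3 d₁)
    (hL' : ∀ c : (Fin (m + m) → Bool) → Bool, IsDegLeFun 3 c → L ≤ (univ.filter fun u => c u ≠ d₂ u).card)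
    (f : (Fin (m + m + 2) → Bool) → Bool) (hf : IsDegLeFun 3 f) :
    forrelation f (fun y : Fin (m + m + 2) → Bool => xor (xor (g₁ fun i => y (Fin.castAdd 2 i))
          ((xor (y (Fin.natAdd (m + m) 0)) (y (Fin.natAdd (m + m) 1))) &&
            (xor (g₁ fun i => y (Fin.castAdd 2 i)) (g₂ fun i => y (Fin.castAdd 2 i)))))
          (y (Fin.natAdd (m + m) 0) && y (Fin.natAdd (m + m) 1))) ≤ 1 - (L : ℝ) / 2 ^ (m + m) :=
  cd_forrelation_concat_le g₁ g₂ d₁ d₂ L h₁ h₂ (cd_quadratic_bound_of_cubic d₁ d₂ L hd₁ hL') f hf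

/-- **No exact partner.** If `d₁` is cubic and `d₂` is NOT cubic, the 4-concatenation `G` has no exact cubic
partner: `Φ(f, G) ≠ 1` for every cubic `f` (indeed `Φ(f, G) ≤ 1 − 2^{−(m+m)}`). -/
theorem cd_no_exact_partner (g₁ g₂ d₁ d₂ : (Fin (m + m) → Bool) → Bool)
    (h₁ : ∀ u, W (fun y => signOf (g₁ y)) u = (2 : ℝ) ^ m * signOf (d₁ u))
    (h₂ : ∀ u, W (fun y => signOf (g₂ y)) u = (2 : ℝ) ^ m * signOf (d₂ u))
    (hd₁ : IsDegLeFun 3 d₁) (hd₂ : ¬ IsDegLeFun 3 d₂)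
    (f : (Fin (m + m + 2) → Bool) → Bool) (hf : IsDegLeFun 3 f) :
    forrelation f (fun y : Fin (m + m + 2) → Bool => xor (xor (g₁ fun i => y (Fin.castAdd 2 i))
          ((xor (y (Fin.natAdd (m + m) 0)) (y (Fin.natAdd (m + m) 1))) &&
            (xor (g₁ fun i => y (Fin.castAdd 2 i)) (g₂ fun i => y (Fin.castAdd 2 i)))))
          (y (Fin.natAdd (m + m) 0) && y (Fin.natAdd (m + m) 1))) ≠ 1 := by
  have hL' : ∀ c : (Fin (m + m) → Bool) → Bool, IsDegLeFun 3 c →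
      1 ≤ (univ.filter fun u => c u ≠ d₂ u).card := by
    intro c hc
    rw [Nat.one_le_iff_ne_zero, Ne, card_eq_zero, filter_eq_empty_iff]
    intro hall
    apply hd₂
    have e : c = d₂ := funext fun u => by simpa using hall (mem_univ u)
    rwa [e] at hc
  have h := cd_forrelation_concat_le_of_cubic g₁ g₂ d₁ d₂ 1 h₁ h₂ hd₁ hL' f hf
  have h2 : (0 : ℝ) < ((1 : ℕ) : ℝ) / (2 : ℝ) ^ (m + m) := by positivity
  intro heq
  rw [heq] at h
  linarith

/-! ### Two exact pieces: `Φ_max(G) ∈ {1} ∪ [0, 7/8]` -/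

/-- **Exact branch.** If `d₂` is cubic and the dual difference `d₁ ⊕ d₂` is quadratic, the dual pattern
`D = d₂ ‖ d₁ ‖ d₁ ‖ ¬d₂` is cubic and is an exact partner of `G`: `Φ(D, G) = 1`. -/
theorem cd_concat_exact_of_quadratic_diff (g₁ g₂ d₁ d₂ : (Fin (m + m) → Bool) → Bool)
    (h₁ : ∀ u, W (fun y => signOf (g₁ y)) u = (2 : ℝ) ^ m * signOf (d₁ u))
    (h₂ : ∀ u, W (fun y => signOf (g₂ y)) u = (2 : ℝ) ^ m * signOf (d₂ u))
    (hd₂ : IsDegLeFun 3 d₂) (hq : IsDegLeFun 2 (fun u => d₁ u ^^ d₂ u)) :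
    IsDegLeFun 3 (fun z : Fin (m + m + 2) → Bool => xor (xor (d₂ fun i => z (Fin.castAdd 2 i))
          ((xor (z (Fin.natAdd (m + m) 0)) (z (Fin.natAdd (m + m) 1))) &&
            (xor (d₁ fun i => z (Fin.castAdd 2 i)) (d₂ fun i => z (Fin.castAdd 2 i)))))
          (z (Fin.natAdd (m + m) 0) && z (Fin.natAdd (m + m) 1))) ∧
    forrelation (fun z : Fin (m + m + 2) → Bool => xor (xor (d₂ fun i => z (Fin.castAdd 2 i))
          ((xor (z (Fin.natAdd (m + m) 0)) (z (Fin.natAdd (m + m) 1))) &&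
            (xor (d₁ fun i => z (Fin.castAdd 2 i)) (d₂ fun i => z (Fin.castAdd 2 i)))))
          (z (Fin.natAdd (m + m) 0) && z (Fin.natAdd (m + m) 1)))
      (fun y : Fin (m + m + 2) → Bool => xor (xor (g₁ fun i => y (Fin.castAdd 2 i))
          ((xor (y (Fin.natAdd (m + m) 0)) (y (Fin.natAdd (m + m) 1))) &&
            (xor (g₁ fun i => y (Fin.castAdd 2 i)) (g₂ fun i => y (Fin.castAdd 2 i)))))
          (y (Fin.natAdd (m + m) 0) && y (Fin.natAdd (m + m) 1))) = 1 := by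
  have hW := bb_W_concat_of_duals g₁ g₂ d₁ d₂ ((2 : ℝ) ^ m) h₁ h₂
  refine ⟨?_, ?_⟩
  · have hA : IsDegLeFun 3 (fun z : Fin (m + m + 2) → Bool => d₂ fun i => z (Fin.castAdd 2 i)) :=
      bb_deg_lift hd₂
    have hB : IsDegLeFun 1 (fun z : Fin (m + m + 2) → Bool =>
        xor (z (Fin.natAdd (m + m) 0)) (z (Fin.natAdd (m + m) 1))) :=
      bb_deg_xor (bb_deg_coord _) (bb_deg_coord _)
    have hC : IsDegLeFun 2 (fun z : Fin (m + m + 2) → Bool =>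
        xor (d₁ fun i => z (Fin.castAdd 2 i)) (d₂ fun i => z (Fin.castAdd 2 i))) := bb_deg_lift hq
    have hD : IsDegLeFun 3 (fun z : Fin (m + m + 2) → Bool =>
        z (Fin.natAdd (m + m) 0) && z (Fin.natAdd (m + m) 1)) :=
      bb_deg_and (bb_deg_coord _) (bb_deg_coord _) (by norm_num)
    exact bb_deg_xor (bb_deg_xor hA (bb_deg_and hB hC le_rfl)) hD
  · rw [cd_forrelation_eq_of_dual _ _ _ (fun z => by rw [hW z, cd_sqrt_two_pow])]
    have e : (univ.filter fun x : Fin (m + m + 2) → Bool => (fun z : Fin (m + m + 2) → Bool => xor (xor (d₂ fun i => z (Fin.castAdd 2 i))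
          ((xor (z (Fin.natAdd (m + m) 0)) (z (Fin.natAdd (m + m) 1))) &&
            (xor (d₁ fun i => z (Fin.castAdd 2 i)) (d₂ fun i => z (Fin.castAdd 2 i)))))
          (z (Fin.natAdd (m + m) 0) && z (Fin.natAdd (m + m) 1))) x ≠ (fun z : Fin (m + m + 2) → Bool => xor (xor (d₂ fun i => z (Fin.castAdd 2 i))
          ((xor (z (Fin.natAdd (m + m) 0)) (z (Fin.natAdd (m + m) 1))) &&
            (xor (d₁ fun i => z (Fin.castAdd 2 i)) (d₂ fun i => z (Fin.castAdd 2 i)))))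
          (z (Fin.natAdd (m + m) 0) && z (Fin.natAdd (m + m) 1))) x) = ∅ :=
      filter_eq_empty_iff.2 fun x _ h => h rfl
    rw [e, card_empty]
    simp

/-- **`7/8` branch.** If both duals are cubic but `d₁ ⊕ d₂` is NOT quadratic, every cubic `f` has
`Φ(f, G) ≤ 7/8`. -/
theorem cd_concat_le_seven_eighths (g₁ g₂ d₁ d₂ : (Fin (m + m) → Bool) → Bool)
    (h₁ : ∀ u, W (fun y => signOf (g₁ y)) u = (2 : ℝ) ^ m * signOf (d₁ u))
    (h₂ : ∀ u, W (fun y => signOf (g₂ y)) u = (2 : ℝ) ^ m * signOf (d₂ u))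
    (hd₁ : IsDegLeFun 3 d₁) (hd₂ : IsDegLeFun 3 d₂) (hq : ¬ IsDegLeFun 2 (fun u => d₁ u ^^ d₂ u))
    (f : (Fin (m + m + 2) → Bool) → Bool) (hf : IsDegLeFun 3 f) :
    forrelation f (fun y : Fin (m + m + 2) → Bool => xor (xor (g₁ fun i => y (Fin.castAdd 2 i))
          ((xor (y (Fin.natAdd (m + m) 0)) (y (Fin.natAdd (m + m) 1))) &&
            (xor (g₁ fun i => y (Fin.castAdd 2 i)) (g₂ fun i => y (Fin.castAdd 2 i)))))
          (y (Fin.natAdd (m + m) 0) && y (Fin.natAdd (m + m) 1))) ≤ 7 / 8 := by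
  have h := cd_forrelation_concat_le_mul g₁ g₂ d₁ d₂ 8 (2 ^ (m + m)) (by norm_num) h₁ h₂
    (cd_eight_mul_card_of_cubic_diff d₁ d₂ hd₁ hd₂ hq) f hf
  have h2 : (0 : ℝ) < (2 : ℝ) ^ (m + m) := by positivity
  have e : ((2 ^ (m + m) : ℕ) : ℝ) / (((8 : ℕ) : ℝ) * 2 ^ (m + m)) = 1 / 8 := by
    rw [div_eq_div_iff (by positivity) (by norm_num)]
    push_cast
    ring
  rw [e] at h
  linarith

end Summit.QuantumAdvantage.QuantumAdvantage.Theorems.NearExactIsExact.Negative.ConcatDefect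

end
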